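import Literature.AlgebraicGeometry.GroupSchemes.BarsottiTateGroupFormallySmooth
import Literature.AlgebraicGeometry.GroupSchemes.AffineGroupSchemeHopfAlgebra
import Literature.AlgebraicGeometry.GroupSchemes.GeneralLinearGroupSchemeBaseChange
import Literature.RingTheory.HopfAlgebra.ReductionKernelTorsion
import HarnessLib

/-!
# `N^ν` kills the kernel of reduction of a Barsotti–Tate group — the named fact `Katz1981_pow_eq_one_of_restrict_eq_one` PROVED

Topic `Literature/AlgebraicGeometry/GroupSchemes`; namespace `Literature.AlgebraicGeometry.GroupSchemes` (+ `BTGroup`).  THEOREMS ONLY (no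
definition, no named fact, no instance, no notation, no `sorry`).  Cell `hodgecm-mathlib` (D-0151 ∕ D-0183 FLOOR 0), P6 «MOD programme», organ (G5)
of the sub-line P6b `Cruxes/HLiu418/Lines/F0_P6b_BTSerreTate.lean` ED. 1: DISCHARGE of the second named fact of ★ `BarsottiTateGroupFormallySmooth`
(p844635), `BTGroup.Katz1981_pow_eq_one_of_restrict_eq_one` = [Katz1981SerreTate] Lemma 1.1.2 for `p`-divisible groups (the (D2) rigidity input
of `stub_L4B1ff`), by `Katz1981_pow_eq_one_of_restrict_eq_one_holds` (D-0026 debt −1).  `--supports stmt-HodgeConjecture-24832`; COUNT-NEUTRAL: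
HC_CM is proved only modulo the printed citations until rung 0 closes; nothing here is about HC.

THE PRINT.  [Katz1981SerreTate] §1.1 (ring `R` killed by `N`, `I ⊆ R` with `I^{ν+1} = 0`): Lemma 1.1.1 (a commutative formal Lie group: `[N](G_{I^a})
⊆ G_{I^{2a}}`, so `N^ν` kills `G_I = Ker(G(A) → G(A⧸IA))`), Lemma 1.1.2 (the same for an fppf sheaf whose `Ĝ` is a formal Lie group) and the proof
of Thm. 1.2.1 («both abelian schemes and `p`-divisible groups satisfy all the hypotheses of 1.1.3»).  Katz reaches `p`-divisible groups through
[Messing1972] II (3.3.18) (`Ḡ` is a formal Lie group); for the LAYERS `G n` of a Barsotti–Tate group — AFFINE group schemes — no formal Lie group is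
needed: Katz's computation `(1 + D)^N` runs verbatim in the CONVOLUTION algebra `Hom_A(Γ(G n), A′)` (F0P6-p09 ★ `RingTheory/HopfAlgebra/ReductionKernelTorsion`:
`algHom_convPow_pow_eq_one_of_comp_mkₐ_eq_unit`), which is how this file proves the fact.

ROAD (all ★): a point `x : Spec A → G n` over `a : Spec A → S` (test ring `A` with `p^t = 0`, `J^{ν+1} = 0`) ↦ (precompose the identity
`Spec A →(𝟙) Spec A`, written `Spec (algebraMap A A)`) a point of `(Over.map a).obj (specOver A A)` ↦ (transpose along `Over.map a ⊣ Over.pullback a`,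
MULTIPLICATIVELY: ★ `adjunctionHomMulEquiv` of `GeneralLinearGroupSchemeBaseChange` §0) a section `s` of the base-changed layer `Y = G n ×_S Spec A`
(finite, hence AFFINE over `Spec A`; group law `Functor.grpObjObj`) ↦ (★ `AffineGroupScheme.ptEquiv ∕ ptMulEquiv`, B-p04 p844646) an algebra map
`g : Γ(Y) →ₐ[A] A`, MULTIPLICATIVELY into Mathlib's convolution group `WithConv (Γ(Y) →ₐ[A] A)`; the restriction hypothesis «`x ∣ Spec (A⧸J) = 1`»
becomes (naturality `Adjunction.homEquiv_naturality_left`, ★ `ptEquiv_comap`, ★ `ptMulEquiv_one`, Mathlib `AlgHom.convOne_def`) «`(A → A⧸J) ∘ g` is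
the unit point», and ★ `algHom_convPow_pow_eq_one_of_comp_mkₐ_eq_unit` gives `g^{(p^t)^ν} = 1`; transport back.

* §1 `map_obj_specOver` (`rfl`), `mapPullbackAdj_homEquiv_pow` (transposition commutes with powers);
* §2 **`BTGroup.Katz1981_pow_eq_one_of_restrict_eq_one_holds : Katz1981_pow_eq_one_of_restrict_eq_one`**.

## References
* [Katz1981SerreTate] N. Katz, *Serre–Tate local moduli*, LNM 868 (1981), exp. Vbis — §1.1 Lemmas 1.1.1–1.1.2, §1.2 proof of Thm. 1.2.1 (pp. 138–142).
* [Messing1972] W. Messing, *The Crystals Associated to Barsotti–Tate Groups*, LNM 264 (1972) — Ch. II (3.3.18).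
* [GortzWedhorn2020] U. Görtz, T. Wedhorn, *Algebraic Geometry I*, 2nd ed. (2020) — (4.15) and Definition 4.42 (p. 116) (points of a base change).
-/

noncomputable section

-- Mathlib's `Over`/pull-back API is stated across semireducible wrappers (as in the ★ `GroupSchemes/*` files).
set_option backward.isDefEq.respectTransparency false

universe u

open CategoryTheory CategoryTheory.Limits AlgebraicGeometry MonoidalCategory CartesianMonoidalCategory WithConv
open scoped MonObj CategoryTheory.Obj

namespace Literature.AlgebraicGeometry.GroupSchemes

open Literature.AlgebraicGeometry.Motives (specOver SchemeOver)
open Literature.AlgebraicGeometry.Motives.AlgPoints (specOverMapOfAlgHom specOverMapOfAlgHom_left)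

/-! ## §1 Points over `a : Spec A → S` as points of the base change `G ×_S Spec A`, as GROUPS -/

section Points

variable {S : Scheme.{u}} {A : Type u} [CommRing A] (a : Spec (.of A) ⟶ S) (G : Over S) [GrpObj G]

/-- `Over.map a` sends the `A`-scheme `Spec A′` to the `S`-scheme `Spec A′ → Spec A → S` (`rfl`). [cite: GortzWedhorn2020, (4.15), p. 116] -/
theorem map_obj_specOver (A' : Type u) [CommRing A'] [Algebra A A'] :
    (Over.map a).obj (specOver A A') = Over.mk (Spec.map (CommRingCat.ofHom (algebraMap A A')) ≫ a) :=
  rfl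

/-- **`G(Spec A′ → S) ≃* (G ×_S Spec A)(Spec A′)`**: points of the `S`-group scheme `G` with values in `Spec A′` over `a` are the
`A′`-points of the base change `G ×_S Spec A` (transported group law), multiplicatively — ★ `adjunctionHomMulEquiv` for
`Over.map a ⊣ Over.pullback a`. [cite: GortzWedhorn2020, (4.15) and Definition 4.42, p. 116] -/
theorem mapPullbackAdj_homEquiv_pow (A' : Type u) [CommRing A'] [Algebra A A']
    (x : (Over.map a).obj (specOver A A') ⟶ G) (k : ℕ) :
    (Over.mapPullbackAdj a).homEquiv (specOver A A') G (x ^ k) =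
      ((Over.mapPullbackAdj a).homEquiv (specOver A A') G x) ^ k :=
  map_pow (adjunctionHomMulEquiv (Over.mapPullbackAdj a) (specOver A A') G) x k

end Points

namespace BTGroup

/-! ## §2 The named fact of ★ `BarsottiTateGroupFormallySmooth` §5 is a THEOREM -/

/-- **[Katz1981SerreTate] Lemma 1.1.2 for `p`-divisible groups, PROVED** (no formal Lie group needed — for SCHEMES the kernel of reduction along a
square-zero ideal is governed by the first-order calculus, and F0P6-p09's ★ `ReductionKernelTorsion` runs Katz's `(1 + D)^N` computation in the
convolution algebra of an AFFINE group scheme): `p^t = 0` in `A`, `J^{ν+1} = 0`, `x : Spec A → G n` over `a : Spec A → S` restricting to the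
unit over `Spec (A⧸J)` ⇒ `x^{(p^t)^ν} = 1`.  Road: base change to `Spec A` (`Over.map a ⊣ Over.pullback a`, multiplicative ★
`adjunctionHomMulEquiv`; the layer `G n ×_S Spec A` is finite, hence affine, over `Spec A`), points ↦ algebra maps of the Hopf algebra
`Γ(G n ×_S Spec A)` multiplicatively (★ `AffineGroupScheme.ptMulEquiv`, B-p04), restriction ↦ composition with `A → A⧸J` (★ `ptEquiv_comap`),
and ★ `Literature.RingTheory.HopfAlgebra.algHom_convPow_pow_eq_one_of_comp_mkₐ_eq_unit` (F0P6-p09).  Discharges the named fact ★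
`BTGroup.Katz1981_pow_eq_one_of_restrict_eq_one` (debt −1).
[cite: Katz1981SerreTate, Lemmas 1.1.1–1.1.2 and proof of Thm. 1.2.1 (§1.1–1.2, pp. 138–142)] [cite: Messing1972, Ch. II (3.3.18)] -/
theorem Katz1981_pow_eq_one_of_restrict_eq_one_holds : Katz1981_pow_eq_one_of_restrict_eq_one.{u} := by
  intro S p h B hp A _ t ν hpt J hJ a n x hx
  letI hG : GrpObj (B.G n) := B.grpObj n
  haveI hGc : IsCommMonObj (B.G n) := B.comm n
  -- the base-changed layer `Y = G n ×_S Spec A` with its transported group law (scoped instance `Obj`, bound locally)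
  letI hY : GrpObj ((Over.pullback a).obj (B.G n)) := Functor.grpObjObj (F := Over.pullback a)
  -- §0 `Y` is affine (the layer is finite over `S`)
  haveI hAffHom : IsAffineHom ((Over.pullback a).obj (B.G n)).hom := by
    haveI := B.isFinite n
    change IsAffineHom (pullback.snd (B.G n).hom a)
    exact MorphismProperty.pullback_snd _ _ inferInstance
  haveI hAff : IsAffine ((Over.pullback a).obj (B.G n)).left :=
    AffineGroupScheme.isAffine_left_of_isAffineHom ((Over.pullback a).obj (B.G n))
  -- §1 move `x` to the test object `(Over.map a).obj (specOver A A) = (Spec A →(𝟙) Spec A → S)`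
  let i₁ : (Over.map a).obj (specOver A A) ⟶ Over.mk a :=
    Over.homMk (Spec.map (CommRingCat.ofHom (algebraMap A A))) rfl
  have hi₁left : i₁.left = 𝟙 (Spec (.of A)) := by
    change Spec.map (CommRingCat.ofHom (algebraMap A A)) = 𝟙 _
    rw [Algebra.algebraMap_self, CommRingCat.ofHom_id, Spec.map_id]
  let j₁ : Over.mk a ⟶ (Over.map a).obj (specOver A A) :=
    Over.homMk (𝟙 (Spec (.of A))) (by
      change 𝟙 _ ≫ Spec.map (CommRingCat.ofHom (algebraMap A A)) ≫ a = a
      rw [Algebra.algebraMap_self, CommRingCat.ofHom_id, Spec.map_id, Category.id_comp, Category.id_comp])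
  have hji : j₁ ≫ i₁ = 𝟙 _ := by
    ext
    change 𝟙 (Spec (.of A)) ≫ i₁.left = 𝟙 _
    rw [hi₁left, Category.id_comp]
  let x' : (Over.map a).obj (specOver A A) ⟶ B.G n := i₁ ≫ x
  have hxx' : x = j₁ ≫ x' := by
    change x = j₁ ≫ i₁ ≫ x
    rw [← Category.assoc, hji, Category.id_comp]
  -- §2 the section of the base change and its algebra map
  let s : specOver A A ⟶ (Over.pullback a).obj (B.G n) := (Over.mapPullbackAdj a).homEquiv _ _ x'
  let g : AffineGroupScheme.Alg ((Over.pullback a).obj (B.G n)) →ₐ[A] A :=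
    AffineGroupScheme.ptEquiv ((Over.pullback a).obj (B.G n)) A s
  -- §3 the restriction hypothesis, transported
  let f : specOver A (A ⧸ J) ⟶ specOver A A := specOverMapOfAlgHom (Ideal.Quotient.mkₐ A J)
  have hres : (Over.map a).map f ≫ x' = 1 := by
    have e : (Over.map a).map f ≫ i₁ =
        (Over.homMk (Spec.map (CommRingCat.ofHom (Ideal.Quotient.mk J))) :
          Over.mk (Spec.map (CommRingCat.ofHom (Ideal.Quotient.mk J)) ≫ a) ⟶ Over.mk a) := by
      apply Over.OverMorphism.ext
      change Spec.map (CommRingCat.ofHom (Ideal.Quotient.mkₐ A J).toRingHom) ≫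
          Spec.map (CommRingCat.ofHom (algebraMap A A)) = Spec.map (CommRingCat.ofHom (Ideal.Quotient.mk J))
      rw [← Spec.map_comp, ← CommRingCat.ofHom_comp]
      rfl
    change (Over.map a).map f ≫ i₁ ≫ x = 1
    rw [← Category.assoc, e]
    exact hx
  have hs : f ≫ s = (1 : specOver A (A ⧸ J) ⟶ (Over.pullback a).obj (B.G n)) := by
    change f ≫ (Over.mapPullbackAdj a).homEquiv _ _ x' = 1
    rw [← (Over.mapPullbackAdj a).homEquiv_naturality_left, hres]
    exact adjunction_homEquiv_one (Over.mapPullbackAdj a)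
  have hg : (Ideal.Quotient.mkₐ A J).comp g =
      (Ideal.Quotient.mkₐ A J).comp ((Algebra.ofId A A).comp
        (Bialgebra.counitAlgHom A (AffineGroupScheme.Alg ((Over.pullback a).obj (B.G n))))) := by
    have h1 : (Ideal.Quotient.mkₐ A J).comp g =
        AffineGroupScheme.ptEquiv ((Over.pullback a).obj (B.G n)) (A ⧸ J) (f ≫ s) :=
      (AffineGroupScheme.ptEquiv_comap ((Over.pullback a).obj (B.G n)) (Ideal.Quotient.mkₐ A J) s).symm
    have h2 : toConv (AffineGroupScheme.ptEquiv ((Over.pullback a).obj (B.G n)) (A ⧸ J) (f ≫ s)) = 1 := by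
      rw [hs, ← AffineGroupScheme.ptMulEquiv_apply, AffineGroupScheme.ptMulEquiv_one]
    rw [h1, ← WithConv.toConv_injective.eq_iff, h2, AlgHom.convOne_def]
    rfl
  -- §4 Katz's computation in the convolution algebra (★ F0P6-p09)
  have hN : ∀ y ∈ J, (((p ^ t : ℕ) : A)) * y = 0 := fun y _ => by
    rw [Nat.cast_pow, hpt, zero_mul]
  have hconv : (toConv g) ^ (p ^ t) ^ ν = 1 :=
    Literature.RingTheory.HopfAlgebra.algHom_convPow_pow_eq_one_of_comp_mkₐ_eq_unit g hg hN hJ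
  -- §5 back to `s`, to `x'`, to `x`
  have hs' : s ^ (p ^ t) ^ ν = 1 := by
    apply (AffineGroupScheme.ptMulEquiv ((Over.pullback a).obj (B.G n)) A).injective
    rw [map_pow, AffineGroupScheme.ptMulEquiv_apply, hconv, AffineGroupScheme.ptMulEquiv_one]
  have hx' : x' ^ (p ^ t) ^ ν = 1 := by
    apply ((Over.mapPullbackAdj a).homEquiv (specOver A A) (B.G n)).injective
    rw [mapPullbackAdj_homEquiv_pow, adjunction_homEquiv_one (Over.mapPullbackAdj a)]
    exact hs'
  rw [hxx', ← MonObj.comp_pow, hx', MonObj.comp_one]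

end BTGroup

end Literature.AlgebraicGeometry.GroupSchemes

end
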